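import Literature.GroupTheory.CombinatorialGroupTheory.RibbonGraphGeometricBasisSplit
import HarnessLib

/-!
# Every one-vertex ribbon graph has a geometric free basis

Topic `Literature/GroupTheory/CombinatorialGroupTheory`; concludes the `RibbonGraphGeometricBasis*`
files.  **Theorem** (`RibbonGraph.exists_geometricBasis`): for a finite nonempty edge set `E` and a
transitive rotation `ρ` of its darts, there are `g`, `m` with `2g + m = |E|` and a geometric basis
of `(E, ρ)`: a free basis `A_i, B_i (i < g), C_k (k < m)` of `F(E)` such that the `m + 1` boundary
cycles of `face ρ`, read as words, are conjugate to `C_0, …, C_{m-1}` and to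
`(∏_i [A_i, B_i] · C_0 ⋯ C_{m-1})⁻¹`.  Proof: induction on `|E|`, deleting an edge `e`; the base
case is the annulus (`GeometricBasis.ofUnique`); in the inductive step the two darts of `e` lie
on different boundary cycles (`mergeStep`) or on the same one (`splitStep`), after rotating the
basis of the smaller graph so that the affected cycle is the distinguished one
(`GeometricBasis.exists_rep_last_sameCycle`).  This is the fat-graph form of the classification
of compact orientable surfaces with nonempty boundary (Zieschang–Vogt–Coldewey LNM 835 §3;
Mohar–Thomassen §3.4), with the boundary kept track of.
-/

namespace Literature.GroupTheory.CombinatorialGroupTheory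

namespace RibbonGraph

open Equiv Equiv.Perm Function

universe u

variable {E : Type u}

/-- `natCard_ne_add_one`: bookkeeping lemma of this construction (see the module docstring). [cite: ZieschangVogtColdewey1980, Prop. 3.2.4 and Thm. 3.2.8] -/
theorem natCard_ne_add_one [Finite E] [DecidableEq E] (e : E) :
    Nat.card {x : E // x ≠ e} + 1 = Nat.card E := by
  rw [← Nat.card_unique (α := Unit), ← Nat.card_sum]
  exact Nat.card_congr (optionNeEquiv e)

/-- The inductive step, MERGE case. [cite: ZieschangVogtColdewey1980, Prop. 3.2.4 and Thm. 3.2.8] -/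
theorem exists_geometricBasis_of_not_sameCycle [Finite E] [DecidableEq E] {ρ : Perm (Dart E)}
    (hρ : IsTransitive ρ) {e e' : E} (hee' : e' ≠ e) (hne : ¬ (face ρ).SameCycle (e, true) (e, false))
    {g m : ℕ} (G : GeometricBasis (delRot ρ e) g m) : Nonempty (GeometricBasis ρ g (m + 1)) := by
  obtain ⟨p, hp⟩ : ∃ p, minimalPeriod (face ρ) (e, true) = p + 1 :=
    Nat.exists_eq_add_one_of_ne_zero (minimalPeriod_perm_pos _ _).ne'
  obtain ⟨q, hq⟩ : ∃ q, minimalPeriod (face ρ) (e, false) = q + 1 :=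
    Nat.exists_eq_add_one_of_ne_zero (minimalPeriod_perm_pos _ _).ne'
  have hpq : 0 < p + q := by
    by_contra h0
    obtain ⟨rfl, rfl⟩ : p = 0 ∧ q = 0 := by omega
    have h1 : face ρ (e, true) = (e, true) := by
      have := pow_minimalPeriod_perm (face ρ) (e, true); rwa [hp, zero_add, pow_one] at this
    have h2 : face ρ (e, false) = (e, false) := by
      have := pow_minimalPeriod_perm (face ρ) (e, false); rwa [hq, zero_add, pow_one] at this
    exact hρ.not_face_fixed_both hee' h1 h2
  obtain ⟨z₀, hz₀⟩ := exists_dartEmb_eq e (d := mergeSeq ρ e p 0) (mergeSeq_zero_fst_ne hne hp hq hpq)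
  obtain ⟨k₀, hk₀⟩ := G.rep_surj z₀
  obtain ⟨G', hG'⟩ := G.exists_rep_last_sameCycle k₀
  have hlast : (delFace ρ e).SameCycle (dartEmb e (G'.rep (Fin.last m))) (mergeSeq ρ e p 0) := by
    rw [← hz₀, ← sameCycle_face_delRot_iff]; exact hG'.trans hk₀
  exact ⟨GeometricBasis.mergeStep hne hp hq hpq G' hlast⟩

/-- The inductive step, SPLIT case. [cite: ZieschangVogtColdewey1980, Prop. 3.2.4 and Thm. 3.2.8] -/
theorem exists_geometricBasis_of_sameCycle [Finite E] [DecidableEq E] {ρ : Perm (Dart E)}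
    (hρ : IsTransitive ρ) {e : E} (hs : (face ρ).SameCycle (e, true) (e, false))
    {g m : ℕ} (G : GeometricBasis (delRot ρ e) g m) :
    ∃ m', m = m' + 1 ∧ Nonempty (GeometricBasis ρ (g + 1) m') := by
  -- the first hitting time of `h̄` from `h`
  obtain ⟨j, hj, hjhit⟩ := exists_lt_minimalPeriod_of_sameCycle (face ρ) hs
  have hj0 : j ≠ 0 := by rintro rfl; simp at hjhit
  obtain ⟨p, rfl⟩ : ∃ p, j = p + 1 := Nat.exists_eq_add_one_of_ne_zero hj0
  obtain ⟨q, hq⟩ : ∃ q, minimalPeriod (face ρ) (e, true) = p + q + 2 :=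
    ⟨minimalPeriod (face ρ) (e, true) - (p + 2), by omega⟩
  have hp1 : 0 < p := by
    rcases Nat.eq_zero_or_pos p with rfl | h
    · exact absurd (by simpa using hjhit) (hρ.face_true_ne_false e)
    · exact h
  have hq1 : 0 < q := by
    rcases Nat.eq_zero_or_pos q with rfl | h
    · exfalso
      apply hρ.face_false_ne_true e
      have := pow_minimalPeriod_perm (face ρ) (e, true)
      rw [hq, add_zero, pow_succ', Perm.mul_apply, hjhit] at this
      exact this
    · exact h
  -- the two new boundary cycles in the smaller graph
  obtain ⟨zU, hzU⟩ := exists_dartEmb_eq e (d := face ρ (e, true))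
    (by simpa using split_pow_true_fst_ne hq hjhit (k := 1) le_rfl hp1)
  obtain ⟨zV, hzV⟩ := exists_dartEmb_eq e (d := face ρ (e, false))
    (by simpa using split_pow_false_fst_ne hq hjhit (k := 1) le_rfl hq1)
  obtain ⟨kU, hkU⟩ := G.rep_surj zU
  obtain ⟨kV, hkV⟩ := G.rep_surj zV
  have hUV : kU ≠ kV := by
    rintro rfl
    apply split_not_sameCycle hq hjhit hp1 hq1
    rw [← hzU, ← hzV, ← sameCycle_face_delRot_iff]
    exact hkU.symm.trans hkV
  obtain ⟨m', rfl⟩ : ∃ m', m = m' + 1 := by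
    rcases Nat.eq_zero_or_pos m with rfl | h
    · exact absurd (Subsingleton.elim (α := Fin 1) kU kV) hUV
    · exact ⟨m - 1, by omega⟩
  refine ⟨m', rfl, ?_⟩
  -- rotate the `V`-cycle into the last slot
  obtain ⟨G', hG'⟩ := G.exists_rep_last_sameCycle kV
  have hVl : (delFace ρ e).SameCycle (dartEmb e (G'.rep (Fin.last (m' + 1)))) (face ρ (e, false)) := by
    rw [← hzV, ← sameCycle_face_delRot_iff]; exact hG'.trans hkV
  -- locate the `U`-cycle among the free slots of the rotated basis
  obtain ⟨a', ha'⟩ := G'.rep_surj zU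
  have ha'l : a' ≠ Fin.last (m' + 1) := by
    rintro rfl
    apply split_not_sameCycle hq hjhit hp1 hq1
    rw [← hzU, ← hzV, ← sameCycle_face_delRot_iff]
    exact ha'.symm.trans (hG'.trans hkV)
  obtain ⟨a, rfl⟩ := Fin.exists_castSucc_eq.mpr ha'l
  have hUa : (delFace ρ e).SameCycle (dartEmb e (G'.rep a.castSucc)) (face ρ (e, true)) := by
    rw [← hzU, ← sameCycle_face_delRot_iff]; exact ha'
  exact ⟨GeometricBasis.splitStep a hq hjhit hp1 hq1 G' hUa hVl⟩

/-- The induction on the number of edges. [cite: ZieschangVogtColdewey1980, Prop. 3.2.4 and Thm. 3.2.8] -/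
theorem exists_geometricBasis_aux : ∀ (n : ℕ) (E : Type u) [Finite E] [DecidableEq E]
    (ρ : Perm (Dart E)), IsTransitive ρ → Nat.card E = n + 1 → ∃ g m, Nonempty (GeometricBasis ρ g m) := by
  intro n
  induction n with
  | zero =>
    intro E _ _ ρ hρ hcard
    obtain ⟨hsub, ⟨e⟩⟩ := Nat.card_eq_one_iff_unique.mp hcard
    exact ⟨0, 1, ⟨GeometricBasis.ofUnique ρ hρ e fun x y => Subsingleton.elim x y⟩⟩
  | succ n ih =>
    intro E _ _ ρ hρ hcard
    have hnt : Nontrivial E := Finite.one_lt_card_iff_nontrivial.mp (by omega)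
    obtain ⟨e⟩ : Nonempty E := inferInstance
    obtain ⟨e', hee'⟩ := exists_ne e
    have hcard' : Nat.card {x : E // x ≠ e} = n + 1 := by
      have := natCard_ne_add_one e; omega
    obtain ⟨g, m, ⟨G⟩⟩ := ih {x : E // x ≠ e} (delRot ρ e) (hρ.delRot e) hcard'
    by_cases hs : (face ρ).SameCycle (e, true) (e, false)
    · obtain ⟨m', -, hG⟩ := exists_geometricBasis_of_sameCycle hρ hs G
      exact ⟨g + 1, m', hG⟩
    · exact ⟨g, m + 1, exists_geometricBasis_of_not_sameCycle hρ hee' hs G⟩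

/-- **Every one-vertex ribbon graph has a geometric free basis**: for a finite nonempty edge set
`E` and a transitive rotation `ρ` of the darts `E × Bool`, there are `g`, `m` with `2g + m = |E|`,
a free basis `A_i, B_i (i < g), C_k (k < m)` of the free group `F(E)`, and an enumeration of the
`m + 1` boundary cycles of the face permutation `ρ ∘ flip` whose boundary words are conjugate
to `C_0, …, C_{m-1}` and to `(∏_{i<g} [A_i, B_i] · C_0 ⋯ C_{m-1})⁻¹` respectively — the
combinatorial classification of the compact orientable surface with boundary thickening the
ribbon graph, genus `g`, `m + 1` boundary components.
[cite: ZieschangVogtColdewey1980, §3.2–3.5 (classification of surfaces via canonical dissections)] -/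
theorem exists_geometricBasis [Finite E] [DecidableEq E] [Nonempty E] (ρ : Perm (Dart E))
    (hρ : IsTransitive ρ) : ∃ g m, Nonempty (GeometricBasis ρ g m) := by
  obtain ⟨n, hn⟩ : ∃ n, Nat.card E = n + 1 :=
    Nat.exists_eq_add_one_of_ne_zero (Nat.card_pos (α := E)).ne'
  exact exists_geometricBasis_aux n E ρ hρ hn

end RibbonGraph

end Literature.GroupTheory.CombinatorialGroupTheory
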